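/-
Copyright: public-domain mathematics; typed transcription for the H21 Literature library (cell lit-balaban,
reader/typer seat r02 gen 5 = literature-prover-lit-balaban-r02-g5-0).

statement-level skeleton of published theorems with citation tags; proofs where landed; nothing here is a claim about the Yang–Mills mass gap

# Bałaban, *Propagators and renormalization transformations for lattice gauge theories. I*,
# Commun. Math. Phys. **95** (1984) 17–40 — the CONCRETE Proposition-1.2 carrier of the torus family:
# the norms (1.108)–(1.109), the cubes Δ(y), Δ̃(y), and the quantities bounded in (1.110)–(1.114),
# in the matrix presentation `Tor (fine n M)` of `B5Prop11SettingModel.latticeSetting`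

[cite: Balaban1984PropagatorsI]  T. Bałaban, Commun. Math. Phys. 95 (1984) 17–40, pp. 35–36 (PDF pp. 19–20), verbatim
(OCR layer of the held scan `paper:balaban1984-cmp95-propagators-rt-i` p0019.txt/p0020.txt, checked against the b2b
renders p019/p020 by the B5 reader, SKELETON rows B5.Eq1.109 / B5.Prop1.2):

  "The most fundamental are the supremum norm `|A| = max_μ sup_x |A_μ(x)|`, `|∇A| = max_{μ,ν} sup_x |(∂_μA_ν)(x)|`, (1.108)
  and the Hölder norm `‖A‖_α = max_μ sup_{x,x′: |x−x′|≤1} |x − x′|^{−α}|A_μ(x) − A_μ(x′)|`,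
  `‖A‖_{1,α} = max_{μ,ν} sup_{x,x′: |x−x′|≤1} |x − x′|^{−α}|(∂_μA_ν)(x) − (∂_μA_ν)(x′)|`.  (1.109)
  Besides these we use also L²-norms.  To describe decay properties we use two families of cubes, both parametrized
  by points of the unit lattice T₁^{(k)}.  Cubes Δ(y) are simply unit cubes of T_η, or Δ(y) = B^k(y), y ∈ T₁^{(k)}.
  Cubes Δ̃(y) are sums of 2^d unit cubes having the point y as a corner, thus they are cubes of size 2 and with a
  center at y.  Let us omit the indices k and η in the following."
  followed by Proposition 1.2 (1.110)–(1.114): the sup bounds for `|(GJ)(x)|, |(∇GJ)(x)|, |(G∇*J)(x)|, |(ΔGJ)(x)|`,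
  `x ∈ Δ̃(y)`, `supp J ⊂ Δ̃(y′)` (1.110); the Hölder bounds for `‖ζ∇GJ‖_α, ‖ζG∇*J‖_α`, `ζ ∈ C₀^∞(Δ̃(y))`, with
  `(‖ζ‖_α + |ζ|)` (1.111); `|(∇G∇*J)(x)|` with `(‖J‖_ε + |J|)` (1.112); `‖ζ∇G∇*J‖_α` with `(‖J‖_{α+ε} + |J|)` (1.113); and
  the six L² bounds `‖ζGJ‖, ‖ζ∇GJ‖, ‖ζG∇*J‖, ‖ζ∇G∇*J‖, ‖ζ∇∇GJ‖, ‖ζG∇*∇*J‖ ≤ O(1)e^{−δ₀|y−y′|}|ζ|‖J‖` (1.114).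

WHAT THIS MODULE IS (SKELETON row B5.Prop1.2; B5 owner typing).  The decl of record of Proposition 1.2 is the abstract
`B5.Prop12Printed (fam : I → B5.Setting)` (`B5.lean`); the torus family of record is
`B5Prop11SettingModel.latticeSetting k n M a o` whose Proposition-1.1 half is concrete (p248298: `B5.Prop11Printed` holds
for it) but whose Proposition-1.2 half is the FREE PARAMETER `o : Prop12Fields (Loc189 n M)`.  THIS FILE DEFINES THAT
PARAMETER CONCRETELY in the same matrix presentation — `prop12FieldsLattice n M a` — so that
`B5.Prop12Printed (fun i => latticeSettingP12 (k i) (n i) (M i) a)` is a concrete kernel statement of Proposition 1.2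
for Bałaban's `G = (Δ_a)⁻¹ = (DeltaA n M a)⁻¹` on the torus (the target of the torus programme recorded in the census of
row B5.Prop1.2: [2]'s Theorem on the torus, Prop 1.1 for G₀, the walk (1.118)–(1.131), the transfer (1.132)–(1.134)).
DEFINITIONS ONLY (every `def` has a body); no statement of the paper is asserted here beyond the typing; the only
theorems are unfolding/sanity lemmas and Prop. 1.1 for the completed carrier BY NAME (`prop11Printed_latticeSettingP12`,
from `B5Prop11SettingModel.prop11Printed_latticeSetting`).

THE DICTIONARY (print ↦ Lean), fine torus `T_η = Tor (fine n M)` (`η = 1/n`, `M_μ` unit cells per direction):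
* `y ∈ T₁^{(k)}` (unit-lattice points) ↦ `Site := Tor M`, embedded by `toFine y = n·y`; `|y − y′|` ↦ `distSite` = the sup
  of the circular coordinate distances of `Tor M` (in units);
* `|x − x′|` on `T_η` ↦ `distU` = (sup of circular coordinate distances in fine steps)`/n` (units);
* `Δ̃(y)` ↦ `cubeT y` = the fine sites within ONE unit of `n·y` in every coordinate (exactly «the 2^d unit cubes having
  y as a corner»); `Δ(y)` ↦ `cube1 y` = the block `B^k(y)` of fine sites `x` with `⌊x/n⌋ = y`;
* `J` ↦ the three summands of `Loc189 n M` (vector / d-tensor / d×d-tensor fields, as in (1.89)); `supp J ⊂ Δ̃(y′)` ↦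
  `suppInL`; `|J|` (1.108) ↦ `supNormL` (r19's `LatticeNorms.supNorm` over all bond indices); `‖J‖_ε` (1.109) ↦ `holderL`
  (r19's `LatticeNorms.holderSeminormB5`: same component index, pairs at distance `≤ 1` unit, plain differences);
* `ζ ∈ C₀^∞(Δ̃(y))` ↦ `Cut := Tor (fine n M) → ℝ` with `cutInL ζ y` (`supp ζ ⊂ Δ̃(y)`; on a lattice every function is the
  restriction of a smooth one), `|ζ|` ↦ `cutSupL`, `‖ζ‖_α + |ζ|` ↦ `cutHL`;
* `G` ↦ `(DeltaA n M a)⁻¹`, `∇` ↦ `B5Prop11Lattice.grad`, `∇*` ↦ `divT`, `∇∇` ↦ `grad2`, `∇*∇*` ↦ `divT2`, `Δ` ↦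
  `B5Prop11Lower.Lap` (`Σ_ν ∇_ν*∇_ν`, the Δ of (1.90); inside `|ΔGJ|` the sign convention is immaterial);
* (1.110) ↦ `eL m J y` (`m = 0,1,2,3` ↔ `|GJ|, |∇GJ|, |G∇*J|, |ΔGJ|` over `Δ̃(y)`); (1.111) ↦ `h1L J α ζ` (`‖ζ∇GJ‖_α` on the
  vector summand, `‖ζG∇*J‖_α` on the tensor summand); (1.112) ↦ `e4L J y` (`|∇G∇*J|` over `Δ̃(y)`); (1.113) ↦ `h2L J α ζ`
  (`‖ζ∇G∇*J‖_α`); (1.114) ↦ `l2locL m J ζ` (the six `ζ`-cut ℓ² norms, `m = 0…5` as in `l2op189`).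
Entries that have no printed content on a summand (e.g. `|G∇*J|` of a vector-field argument) are `0` there, exactly as
`B5Prop11SettingModel.l2op189` does for (1.89).

READING NOTES (located, not divergences of content).  (R1) the fields are complex-valued, as everywhere in the matrix
presentation of `B5Prop11Lattice` (print: real); norms are taken with `‖·‖ = Complex.abs`.  (R2) `|y − y′|`, `|x − x′|`
are read as SUP circular distances on the torus (print does not fix the norm on `Z^d`; any two are equivalent up to a
factor `√d` in `δ₀`).  (R3) the Hölder quotient uses pairs with `0 < |x − x′| ≤ 1` and the same component index, verbatim
from (1.109) via `LatticeNorms.holderSeminormB5` (row B5.Eq1.109, decl of record).  (R4) `a` is a parameter (print: "if we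
put a = 1").

HONEST LABELLING.  Everything here is a definition with body or an elementary unfolding/nonnegativity lemma; the one
substantive theorem (`prop11Printed_latticeSettingP12`) is p248298's by name.  Imports: `B5Prop11SettingModel` (hence
`B5Prop11Lattice`, `B5Prop11Lower`, `B5DeltaA169`, `B5Prop11Plancherel`, `B5`), `LatticeNorms`, Mathlib.  value = the
concrete carrier on which Proposition 1.2 for the torus becomes one kernel statement — typing, NOT summit progress.
-/
import Mathlib
import Literature.MathematicalPhysics.QuantumFieldTheory.Balaban1983to89.B5Prop11SettingModel
import Literature.MathematicalPhysics.QuantumFieldTheory.Balaban1983to89.LatticeNorms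

open Finset

namespace Literature.MathematicalPhysics.QuantumFieldTheory.Balaban1983to89.B5Prop12FieldsLattice

open scoped BigOperators Matrix
open Literature.MathematicalPhysics.QuantumFieldTheory.Balaban1983to89
open Literature.MathematicalPhysics.QuantumFieldTheory.Balaban1983to89.B5Prop11Plancherel
open Literature.MathematicalPhysics.QuantumFieldTheory.Balaban1983to89.B5Prop11Lower
open Literature.MathematicalPhysics.QuantumFieldTheory.Balaban1983to89.B5DeltaA169
open Literature.MathematicalPhysics.QuantumFieldTheory.Balaban1983to89.B5Prop11Lattice
open Literature.MathematicalPhysics.QuantumFieldTheory.Balaban1983to89.B5Prop11SettingModel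
open Literature.MathematicalPhysics.QuantumFieldTheory.Balaban1983to89.LatticeNorms

noncomputable section

variable {d : ℕ}

/-! ## §1  Geometry of the fine torus in units: distances, unit-lattice points, the cubes Δ(y), Δ̃(y) -/

section Geometry

variable (n : ℕ) [NeZero n] (M : Fin d → ℕ) [∀ μ, NeZero (M μ)]

/-- circular coordinate distance of two fine sites, in FINE steps: `dist(x_μ − x′_μ, (nM_μ)ℤ)`.
[cite: Balaban1984PropagatorsI, (1.109) p.35 (|x − x′|)] -/
def cdistF (x x' : Tor (fine n M)) (μ : Fin d) : ℕ := ((x μ - x' μ).valMinAbs).natAbs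

/-- **`|x − x′|` on `T_η`**: the sup circular distance IN UNITS, `(max_μ cdistF)/n` (`η = 1/n`).
[cite: Balaban1984PropagatorsI, (1.109) p.35 (|x − x′| ≤ 1)] -/
def distU (x x' : Tor (fine n M)) : ℝ := ((Finset.univ.sup (cdistF n M x x') : ℕ) : ℝ) / n

/-- **`|y − y′|` on the unit lattice `T₁^{(k)} = Tor M`**: the sup circular distance (in units).
[cite: Balaban1984PropagatorsI, Prop. 1.2 (1.110) p.35 (e^{−δ₀|y−y′|})] -/
def distSite (y y' : Tor M) : ℝ := ((Finset.univ.sup fun μ => ((y μ - y' μ).valMinAbs).natAbs : ℕ) : ℝ)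

/-- the unit-lattice point `y ∈ T₁^{(k)}` as a fine site: `x = n·y` (i.e. `x_μ = y_μ` in units).
[cite: Balaban1984PropagatorsI, p.35 (points of the unit lattice T₁^{(k)})] -/
def toFine (y : Tor M) : Tor (fine n M) := fun μ => (((n * (y μ).val : ℕ) : ℤ) : ZMod (fine n M μ))

/-- **`Δ(y) = B^k(y)`**: the unit cube of fine sites with corner `y` (`⌊x_μ/n⌋ = y_μ`).
[cite: Balaban1984PropagatorsI, p.35 («Cubes Δ(y) are simply unit cubes of T_η, or Δ(y) = B^k(y)»)] -/
def cube1 (y : Tor M) : Finset (Tor (fine n M)) :=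
  Finset.univ.filter fun x => ∀ μ, (x μ).val / n = (y μ).val

/-- **`Δ̃(y)`**: the fine sites within one unit of `n·y` in every coordinate — «sums of 2^d unit cubes having the point
y as a corner, thus they are cubes of size 2 and with a center at y».
[cite: Balaban1984PropagatorsI, p.35 (the cubes Δ̃(y))] -/
def cubeT (y : Tor M) : Finset (Tor (fine n M)) :=
  Finset.univ.filter fun x => ∀ μ, cdistF n M x (toFine n M y) μ ≤ n

/-- the bond indices `(x, μ)` over `Δ̃(y)` (where the sup entries of (1.110) are taken).
[cite: Balaban1984PropagatorsI, Prop. 1.2 (1.110) p.35 (x ∈ Δ̃(y))] -/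
def cubeB (y : Tor M) : Finset (Tor (fine n M) × Fin d) := cubeT n M y ×ˢ Finset.univ

variable {n M}

omit [NeZero n] [∀ μ, NeZero (M μ)] in
/-- `distU x x = 0`. [cite: Balaban1984PropagatorsI, (1.109) p.35] -/
theorem distU_self (x : Tor (fine n M)) : distU n M x x = 0 := by
  unfold distU cdistF
  simp

omit [NeZero n] [∀ μ, NeZero (M μ)] in
/-- `0 ≤ distU x x′`. [cite: Balaban1984PropagatorsI, (1.109) p.35] -/
theorem distU_nonneg (x x' : Tor (fine n M)) : 0 ≤ distU n M x x' := by
  unfold distU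
  positivity

omit [NeZero n] [∀ μ, NeZero (M μ)] in
/-- `distSite y y = 0`. [cite: Balaban1984PropagatorsI, Prop. 1.2 (1.110) p.35] -/
theorem distSite_self (y : Tor M) : distSite M y y = 0 := by
  unfold distSite
  simp

omit [NeZero n] [∀ μ, NeZero (M μ)] in
/-- `0 ≤ distSite y y′`. [cite: Balaban1984PropagatorsI, Prop. 1.2 (1.110) p.35] -/
theorem distSite_nonneg (y y' : Tor M) : 0 ≤ distSite M y y' := by
  unfold distSite
  positivity

/-- the centre belongs to its cube: `n·y ∈ Δ̃(y)`. [cite: Balaban1984PropagatorsI, p.35 (Δ̃(y) has center y)] -/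
theorem toFine_mem_cubeT (y : Tor M) : toFine n M y ∈ cubeT n M y := by
  unfold cubeT cdistF
  simp

end Geometry

/-! ## §2  Supports and the norms (1.108)–(1.109) of the arguments `J ∈ Loc189 n M` -/

section Norms

variable (n : ℕ) [NeZero n] (M : Fin d → ℕ) [∀ μ, NeZero (M μ)]

/-- **`supp J ⊂ Δ̃(y′)`** for the three kinds of arguments. [cite: Balaban1984PropagatorsI, Prop. 1.2 (1.110) p.35 (supp J ⊂ Δ̃(y′))] -/
def suppInL : Loc189 n M → Tor M → Prop
  | .vec J, y => ∀ b, J b ≠ 0 → b.1 ∈ cubeT n M y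
  | .ten J, y => ∀ ν b, J ν b ≠ 0 → b.1 ∈ cubeT n M y
  | .ten2 J, y => ∀ p b, J p b ≠ 0 → b.1 ∈ cubeT n M y

/-- **`|J|`** (1.108): the sup norm over all bond (and tensor) indices. [cite: Balaban1984PropagatorsI, (1.108) p.35] -/
def supNormL : Loc189 n M → ℝ
  | .vec J => supNorm Finset.univ J
  | .ten J => supNorm Finset.univ (fun p : Fin d × (Tor (fine n M) × Fin d) => J p.1 p.2)
  | .ten2 J => supNorm Finset.univ (fun p : (Fin d × Fin d) × (Tor (fine n M) × Fin d) => J p.1 p.2)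

/-- the Hölder seminorm (1.109) of a vector field: same component `μ`, pairs at distance `≤ 1` unit, plain differences
(r19's `holderSeminormB5`, row B5.Eq1.109). [cite: Balaban1984PropagatorsI, (1.109) p.35] -/
def holderV (α : ℝ) (A : Tor (fine n M) × Fin d → ℂ) : ℝ :=
  holderSeminormB5 α (fun b b' : Tor (fine n M) × Fin d => b.2 = b'.2) (fun b b' => distU n M b.1 b'.1)
    Finset.univ A

/-- the Hölder seminorm (1.109) of a `d`-tensor field `(J_ν)` (same `ν` and same component).
[cite: Balaban1984PropagatorsI, (1.109) p.35] -/
def holderT (α : ℝ) (J : Fin d → (Tor (fine n M) × Fin d → ℂ)) : ℝ :=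
  holderSeminormB5 α (fun p p' : Fin d × (Tor (fine n M) × Fin d) => p.1 = p'.1 ∧ p.2.2 = p'.2.2)
    (fun p p' => distU n M p.2.1 p'.2.1) Finset.univ (fun p => J p.1 p.2)

/-- the Hölder seminorm (1.109) of a `d × d`-tensor field. [cite: Balaban1984PropagatorsI, (1.109) p.35] -/
def holderT2 (α : ℝ) (J : Fin d × Fin d → (Tor (fine n M) × Fin d → ℂ)) : ℝ :=
  holderSeminormB5 α (fun p p' : (Fin d × Fin d) × (Tor (fine n M) × Fin d) => p.1 = p'.1 ∧ p.2.2 = p'.2.2)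
    (fun p p' => distU n M p.2.1 p'.2.1) Finset.univ (fun p => J p.1 p.2)

/-- **`‖J‖_ε`** (1.109) for the three kinds of arguments. [cite: Balaban1984PropagatorsI, (1.109) p.35] -/
def holderL (α : ℝ) : Loc189 n M → ℝ
  | .vec J => holderV n M α J
  | .ten J => holderT n M α J
  | .ten2 J => holderT2 n M α J

variable {n M}

/-- `0 ≤ |J|`. [cite: Balaban1984PropagatorsI, (1.108) p.35] -/
theorem supNormL_nonneg (J : Loc189 n M) : 0 ≤ supNormL n M J := by
  cases J with
  | vec J => exact supNorm_nonneg Finset.univ J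
  | ten J => exact supNorm_nonneg Finset.univ (fun p : Fin d × (Tor (fine n M) × Fin d) => J p.1 p.2)
  | ten2 J => exact supNorm_nonneg Finset.univ (fun p : (Fin d × Fin d) × (Tor (fine n M) × Fin d) => J p.1 p.2)

/-- `0 ≤ ‖J‖_α`. [cite: Balaban1984PropagatorsI, (1.109) p.35] -/
theorem holderL_nonneg (α : ℝ) (J : Loc189 n M) : 0 ≤ holderL n M α J := by
  cases J with
  | vec J =>
      simp only [holderL, holderV, holderSeminormB5]
      exact holderSeminorm_nonneg _ _ _ _ _ _
  | ten J =>
      simp only [holderL, holderT, holderSeminormB5]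
      exact holderSeminorm_nonneg _ _ _ _ _ _
  | ten2 J =>
      simp only [holderL, holderT2, holderSeminormB5]
      exact holderSeminorm_nonneg _ _ _ _ _ _

end Norms

/-! ## §3  The cut-offs `ζ ∈ C₀^∞(Δ̃(y))` of (1.111), (1.113), (1.114) -/

section Cuts

variable (n : ℕ) [NeZero n] (M : Fin d → ℕ) [∀ μ, NeZero (M μ)]

/-- **`supp ζ ⊂ Δ̃(y)`** for a real lattice function `ζ` (the lattice reading of `ζ ∈ C₀^∞(Δ̃(y))`).
[cite: Balaban1984PropagatorsI, Prop. 1.2 (1.111) p.35 (ζ ∈ C₀^∞(Δ̃(y)))] -/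
def cutInL (ζ : Tor (fine n M) → ℝ) (y : Tor M) : Prop := ∀ x, ζ x ≠ 0 → x ∈ cubeT n M y

/-- **`|ζ|`**. [cite: Balaban1984PropagatorsI, Prop. 1.2 (1.111), (1.114) pp.35–36] -/
def cutSupL (ζ : Tor (fine n M) → ℝ) : ℝ := supNorm Finset.univ ζ

/-- **`‖ζ‖_α + |ζ|`**. [cite: Balaban1984PropagatorsI, Prop. 1.2 (1.111) p.35] -/
def cutHL (α : ℝ) (ζ : Tor (fine n M) → ℝ) : ℝ :=
  holderSeminormB5 α (fun _ _ : Tor (fine n M) => True) (distU n M) Finset.univ ζ + cutSupL n M ζ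

/-- multiplication of a vector field by the cut-off: `(ζA)_μ(x) = ζ(x)A_μ(x)`.
[cite: Balaban1984PropagatorsI, Prop. 1.2 (1.111) p.35 (ζ∇GJ)] -/
def smulV (ζ : Tor (fine n M) → ℝ) (A : Tor (fine n M) × Fin d → ℂ) : Tor (fine n M) × Fin d → ℂ :=
  fun b => (ζ b.1 : ℂ) * A b

/-- multiplication of a tensor field by the cut-off, componentwise.
[cite: Balaban1984PropagatorsI, Prop. 1.2 (1.111) p.35 (ζ∇GJ)] -/
def smulT {S : Type*} (ζ : Tor (fine n M) → ℝ) (F : S → (Tor (fine n M) × Fin d → ℂ)) :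
    S → (Tor (fine n M) × Fin d → ℂ) :=
  fun s b => (ζ b.1 : ℂ) * F s b

variable {n M}

/-- `0 ≤ |ζ|`. [cite: Balaban1984PropagatorsI, Prop. 1.2 (1.114) p.36] -/
theorem cutSupL_nonneg (ζ : Tor (fine n M) → ℝ) : 0 ≤ cutSupL n M ζ := supNorm_nonneg _ _

/-- `0 ≤ ‖ζ‖_α + |ζ|`. [cite: Balaban1984PropagatorsI, Prop. 1.2 (1.111) p.35] -/
theorem cutHL_nonneg (α : ℝ) (ζ : Tor (fine n M) → ℝ) : 0 ≤ cutHL n M α ζ := by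
  simp only [cutHL, holderSeminormB5]
  exact add_nonneg (holderSeminorm_nonneg _ _ _ _ _ _) (cutSupL_nonneg ζ)

end Cuts

/-! ## §4  The quantities bounded in (1.110)–(1.114) for `G = (Δ_a)⁻¹ = (DeltaA n M a)⁻¹` -/

section Entries

variable (n : ℕ) [NeZero n] (M : Fin d → ℕ) [∀ μ, NeZero (M μ)] (a : ℝ)

/-- **(1.110)**: `m = 0, 1, 2, 3 ↔ sup_{x ∈ Δ̃(y)}` of `|(GJ)(x)|, |(∇GJ)(x)|, |(G∇*J)(x)|, |(ΔGJ)(x)|` — the first,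
second and fourth on the vector-field summand, the third on the tensor summand; `0` elsewhere.
[cite: Balaban1984PropagatorsI, Prop. 1.2 (1.110) p.35] -/
def eL (m : Fin 4) : Loc189 n M → Tor M → ℝ
  | .vec J, y => (![supNorm (cubeB n M y) ((DeltaA n M a)⁻¹ *ᵥ J),
      supNorm (Finset.univ ×ˢ cubeB n M y)
        (fun p : Fin d × (Tor (fine n M) × Fin d) => grad n M ((DeltaA n M a)⁻¹ *ᵥ J) p.1 p.2),
      0,
      supNorm (cubeB n M y) (Lap n M *ᵥ ((DeltaA n M a)⁻¹ *ᵥ J))] : Fin 4 → ℝ) m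
  | .ten J, y => (![0, 0, supNorm (cubeB n M y) ((DeltaA n M a)⁻¹ *ᵥ divT n M J), 0] : Fin 4 → ℝ) m
  | .ten2 _, _ => 0

/-- **(1.111)**: `‖ζ∇GJ‖_α` (vector-field summand) and `‖ζG∇*J‖_α` (tensor summand).
[cite: Balaban1984PropagatorsI, Prop. 1.2 (1.111) p.35] -/
def h1L : Loc189 n M → ℝ → (Tor (fine n M) → ℝ) → ℝ
  | .vec J, α, ζ => holderT n M α (smulT n M ζ (grad n M ((DeltaA n M a)⁻¹ *ᵥ J)))
  | .ten J, α, ζ => holderV n M α (smulV n M ζ ((DeltaA n M a)⁻¹ *ᵥ divT n M J))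
  | .ten2 _, _, _ => 0

/-- **(1.112)**: `sup_{x ∈ Δ̃(y)} |(∇G∇*J)(x)|` (tensor summand). [cite: Balaban1984PropagatorsI, Prop. 1.2 (1.112) p.36] -/
def e4L : Loc189 n M → Tor M → ℝ
  | .ten J, y => supNorm (Finset.univ ×ˢ cubeB n M y)
      (fun p : Fin d × (Tor (fine n M) × Fin d) => grad n M ((DeltaA n M a)⁻¹ *ᵥ divT n M J) p.1 p.2)
  | .vec _, _ => 0
  | .ten2 _, _ => 0

/-- **(1.113)**: `‖ζ∇G∇*J‖_α` (tensor summand). [cite: Balaban1984PropagatorsI, Prop. 1.2 (1.113) p.36] -/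
def h2L : Loc189 n M → ℝ → (Tor (fine n M) → ℝ) → ℝ
  | .ten J, α, ζ => holderT n M α (smulT n M ζ (grad n M ((DeltaA n M a)⁻¹ *ᵥ divT n M J)))
  | .vec _, _, _ => 0
  | .ten2 _, _, _ => 0

/-- **(1.114)**: the six `ζ`-cut L² norms `m = 0…5 ↔ ‖ζGJ‖, ‖ζ∇GJ‖, ‖ζG∇*J‖, ‖ζ∇G∇*J‖, ‖ζ∇∇GJ‖, ‖ζG∇*∇*J‖`, each on
the summand on which that operator acts (as `l2op189` for (1.89)). [cite: Balaban1984PropagatorsI, Prop. 1.2 (1.114) p.36] -/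
def l2locL (m : Fin 6) : Loc189 n M → (Tor (fine n M) → ℝ) → ℝ
  | .vec J, ζ => (![l2 (smulV n M ζ ((DeltaA n M a)⁻¹ *ᵥ J)),
      l2T (smulT n M ζ (grad n M ((DeltaA n M a)⁻¹ *ᵥ J))), 0, 0,
      l2T (smulT n M ζ (grad2 n M ((DeltaA n M a)⁻¹ *ᵥ J))), 0] : Fin 6 → ℝ) m
  | .ten J, ζ => (![0, 0, l2 (smulV n M ζ ((DeltaA n M a)⁻¹ *ᵥ divT n M J)),
      l2T (smulT n M ζ (grad n M ((DeltaA n M a)⁻¹ *ᵥ divT n M J))), 0, 0] : Fin 6 → ℝ) m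
  | .ten2 J, ζ => (![0, 0, 0, 0, 0, l2 (smulV n M ζ ((DeltaA n M a)⁻¹ *ᵥ divT2 n M J))] : Fin 6 → ℝ) m

variable {n M a}

/-- `|GJ|` over `Δ̃(y)` (m = 0, vector-field argument). [cite: Balaban1984PropagatorsI, Prop. 1.2 (1.110) p.35] -/
@[simp] theorem eL_zero_vec (J : Tor (fine n M) × Fin d → ℂ) (y : Tor M) :
    eL n M a 0 (.vec J) y = supNorm (cubeB n M y) ((DeltaA n M a)⁻¹ *ᵥ J) := rfl

/-- `|∇GJ|` over `Δ̃(y)` (m = 1, vector-field argument). [cite: Balaban1984PropagatorsI, Prop. 1.2 (1.110) p.35] -/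
@[simp] theorem eL_one_vec (J : Tor (fine n M) × Fin d → ℂ) (y : Tor M) :
    eL n M a 1 (.vec J) y = supNorm (Finset.univ ×ˢ cubeB n M y)
      (fun p : Fin d × (Tor (fine n M) × Fin d) => grad n M ((DeltaA n M a)⁻¹ *ᵥ J) p.1 p.2) := rfl

/-- `|G∇*J|` over `Δ̃(y)` (m = 2, tensor argument). [cite: Balaban1984PropagatorsI, Prop. 1.2 (1.110) p.35] -/
@[simp] theorem eL_two_ten (J : Fin d → (Tor (fine n M) × Fin d → ℂ)) (y : Tor M) :
    eL n M a 2 (.ten J) y = supNorm (cubeB n M y) ((DeltaA n M a)⁻¹ *ᵥ divT n M J) := rfl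

/-- `|ΔGJ|` over `Δ̃(y)` (m = 3, vector-field argument). [cite: Balaban1984PropagatorsI, Prop. 1.2 (1.110) p.35] -/
@[simp] theorem eL_three_vec (J : Tor (fine n M) × Fin d → ℂ) (y : Tor M) :
    eL n M a 3 (.vec J) y = supNorm (cubeB n M y) (Lap n M *ᵥ ((DeltaA n M a)⁻¹ *ᵥ J)) := rfl

/-- `‖ζ∇GJ‖_α` (vector-field argument). [cite: Balaban1984PropagatorsI, Prop. 1.2 (1.111) p.35] -/
@[simp] theorem h1L_vec (J : Tor (fine n M) × Fin d → ℂ) (α : ℝ) (ζ : Tor (fine n M) → ℝ) :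
    h1L n M a (.vec J) α ζ = holderT n M α (smulT n M ζ (grad n M ((DeltaA n M a)⁻¹ *ᵥ J))) := rfl

/-- `‖ζG∇*J‖_α` (tensor argument). [cite: Balaban1984PropagatorsI, Prop. 1.2 (1.111) p.35] -/
@[simp] theorem h1L_ten (J : Fin d → (Tor (fine n M) × Fin d → ℂ)) (α : ℝ) (ζ : Tor (fine n M) → ℝ) :
    h1L n M a (.ten J) α ζ = holderV n M α (smulV n M ζ ((DeltaA n M a)⁻¹ *ᵥ divT n M J)) := rfl

/-- `|∇G∇*J|` over `Δ̃(y)` (tensor argument). [cite: Balaban1984PropagatorsI, Prop. 1.2 (1.112) p.36] -/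
@[simp] theorem e4L_ten (J : Fin d → (Tor (fine n M) × Fin d → ℂ)) (y : Tor M) :
    e4L n M a (.ten J) y = supNorm (Finset.univ ×ˢ cubeB n M y)
      (fun p : Fin d × (Tor (fine n M) × Fin d) => grad n M ((DeltaA n M a)⁻¹ *ᵥ divT n M J) p.1 p.2) := rfl

/-- `‖ζ∇G∇*J‖_α` (tensor argument). [cite: Balaban1984PropagatorsI, Prop. 1.2 (1.113) p.36] -/
@[simp] theorem h2L_ten (J : Fin d → (Tor (fine n M) × Fin d → ℂ)) (α : ℝ) (ζ : Tor (fine n M) → ℝ) :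
    h2L n M a (.ten J) α ζ = holderT n M α (smulT n M ζ (grad n M ((DeltaA n M a)⁻¹ *ᵥ divT n M J))) := rfl

/-- `‖ζGJ‖` (m = 0). [cite: Balaban1984PropagatorsI, Prop. 1.2 (1.114) p.36] -/
@[simp] theorem l2locL_zero_vec (J : Tor (fine n M) × Fin d → ℂ) (ζ : Tor (fine n M) → ℝ) :
    l2locL n M a 0 (.vec J) ζ = l2 (smulV n M ζ ((DeltaA n M a)⁻¹ *ᵥ J)) := rfl

/-- `‖ζ∇GJ‖` (m = 1). [cite: Balaban1984PropagatorsI, Prop. 1.2 (1.114) p.36] -/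
@[simp] theorem l2locL_one_vec (J : Tor (fine n M) × Fin d → ℂ) (ζ : Tor (fine n M) → ℝ) :
    l2locL n M a 1 (.vec J) ζ = l2T (smulT n M ζ (grad n M ((DeltaA n M a)⁻¹ *ᵥ J))) := rfl

/-- `‖ζG∇*J‖` (m = 2). [cite: Balaban1984PropagatorsI, Prop. 1.2 (1.114) p.36] -/
@[simp] theorem l2locL_two_ten (J : Fin d → (Tor (fine n M) × Fin d → ℂ)) (ζ : Tor (fine n M) → ℝ) :
    l2locL n M a 2 (.ten J) ζ = l2 (smulV n M ζ ((DeltaA n M a)⁻¹ *ᵥ divT n M J)) := rfl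

/-- `‖ζ∇G∇*J‖` (m = 3). [cite: Balaban1984PropagatorsI, Prop. 1.2 (1.114) p.36] -/
@[simp] theorem l2locL_three_ten (J : Fin d → (Tor (fine n M) × Fin d → ℂ)) (ζ : Tor (fine n M) → ℝ) :
    l2locL n M a 3 (.ten J) ζ = l2T (smulT n M ζ (grad n M ((DeltaA n M a)⁻¹ *ᵥ divT n M J))) := rfl

/-- `‖ζ∇∇GJ‖` (m = 4). [cite: Balaban1984PropagatorsI, Prop. 1.2 (1.114) p.36] -/
@[simp] theorem l2locL_four_vec (J : Tor (fine n M) × Fin d → ℂ) (ζ : Tor (fine n M) → ℝ) :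
    l2locL n M a 4 (.vec J) ζ = l2T (smulT n M ζ (grad2 n M ((DeltaA n M a)⁻¹ *ᵥ J))) := rfl

/-- `‖ζG∇*∇*J‖` (m = 5). [cite: Balaban1984PropagatorsI, Prop. 1.2 (1.114) p.36] -/
@[simp] theorem l2locL_five_ten2 (J : Fin d × Fin d → (Tor (fine n M) × Fin d → ℂ)) (ζ : Tor (fine n M) → ℝ) :
    l2locL n M a 5 (.ten2 J) ζ = l2 (smulV n M ζ ((DeltaA n M a)⁻¹ *ᵥ divT2 n M J)) := rfl

/-- `0 ≤` every (1.110) entry. [cite: Balaban1984PropagatorsI, Prop. 1.2 (1.110) p.35] -/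
theorem eL_nonneg (m : Fin 4) (J : Loc189 n M) (y : Tor M) : 0 ≤ eL n M a m J y := by
  cases J with
  | vec J =>
      unfold eL
      fin_cases m <;> simp [supNorm_nonneg]
  | ten J =>
      unfold eL
      fin_cases m <;> simp [supNorm_nonneg]
  | ten2 J => unfold eL; rfl

/-- `0 ≤` every (1.114) entry. [cite: Balaban1984PropagatorsI, Prop. 1.2 (1.114) p.36] -/
theorem l2locL_nonneg (m : Fin 6) (J : Loc189 n M) (ζ : Tor (fine n M) → ℝ) : 0 ≤ l2locL n M a m J ζ := by
  cases J with
  | vec J =>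
      unfold l2locL
      fin_cases m <;> simp [l2_nonneg, l2T_nonneg]
  | ten J =>
      unfold l2locL
      fin_cases m <;> simp [l2_nonneg, l2T_nonneg]
  | ten2 J =>
      unfold l2locL
      fin_cases m <;> simp [l2_nonneg]

end Entries

/-! ## §5  The concrete Proposition-1.2 fields and the completed torus carrier -/

section Carrier

variable (n : ℕ) [NeZero n] (M : Fin d → ℕ) [∀ μ, NeZero (M μ)] (a : ℝ)

/-- **THE CONCRETE PROPOSITION-1.2 FIELDS of the torus family** in the matrix presentation: the parameter `o` of
`B5Prop11SettingModel.latticeSetting` DEFINED — sites `Tor M` and their sup circular distance, `supp J ⊂ Δ̃(y′)`, `|J|`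
(1.108), `‖J‖_ε` (1.109), the cut-offs `ζ` with `supp ζ ⊂ Δ̃(y)`, `‖ζ‖_α + |ζ|`, `|ζ|`, and the quantities of
(1.110)–(1.114) for `G = (DeltaA n M a)⁻¹`. [cite: Balaban1984PropagatorsI, Prop. 1.2 (1.110)–(1.114) pp.35–36, (1.108)–(1.109) p.35] -/
def prop12FieldsLattice : Prop12Fields (Loc189 n M) where
  Site := Tor M
  dist := distSite M
  suppIn := suppInL n M
  supNorm := supNormL n M
  holder := holderL n M
  Cut := Tor (fine n M) → ℝ
  cutIn := cutInL n M
  cutH := cutHL n M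
  cutSup := cutSupL n M
  e := eL n M a
  h1 := h1L n M a
  e4 := e4L n M a
  h2 := h2L n M a
  l2loc := l2locL n M a

/-- **THE COMPLETED TORUS CARRIER** at step label `k`: `latticeSetting` with BOTH halves concrete (Prop. 1.1 half as before,
Prop. 1.2 half = `prop12FieldsLattice`). `B5.Prop12Printed (fun i => latticeSettingP12 (k i) (n i) (M i) a)` is the concrete
statement of Proposition 1.2 for the torus family. [cite: Balaban1984PropagatorsI, Prop. 1.2 (1.110)–(1.114) pp.35–36] -/
def latticeSettingP12 (k : ℕ) : B5.Setting := latticeSetting k n M a (prop12FieldsLattice n M a)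

variable {n M a}

/-- unfolding: the sites are the unit-lattice points `Tor M`. [cite: Balaban1984PropagatorsI, p.35 (T₁^{(k)})] -/
theorem latticeSettingP12_Site (k : ℕ) : (latticeSettingP12 n M a k).Site = Tor M := rfl

/-- unfolding: the arguments are `Loc189 n M`. [cite: Balaban1984PropagatorsI, Prop. 1.1 (1.89) p.33] -/
theorem latticeSettingP12_Loc (k : ℕ) : (latticeSettingP12 n M a k).Loc = Loc189 n M := rfl

/-- unfolding: the cut-offs are the real lattice functions. [cite: Balaban1984PropagatorsI, Prop. 1.2 (1.111) p.35] -/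
theorem latticeSettingP12_Cut (k : ℕ) : (latticeSettingP12 n M a k).Cut = (Tor (fine n M) → ℝ) := rfl

/-- unfolding: the (1.110) entries are `eL`. [cite: Balaban1984PropagatorsI, Prop. 1.2 (1.110) p.35] -/
theorem latticeSettingP12_e (k : ℕ) : (latticeSettingP12 n M a k).e = eL n M a := rfl

/-- unfolding: the (1.114) entries are `l2locL`. [cite: Balaban1984PropagatorsI, Prop. 1.2 (1.114) p.36] -/
theorem latticeSettingP12_l2loc (k : ℕ) : (latticeSettingP12 n M a k).l2loc = l2locL n M a := rfl

/-- unfolding: the Prop. 1.1 half is unchanged (`l2op189`). [cite: Balaban1984PropagatorsI, Prop. 1.1 (1.89) p.33] -/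
theorem latticeSettingP12_l2op (k : ℕ) : (latticeSettingP12 n M a k).l2op = l2op189 n M a := rfl

/-- unfolding: `dist` is the sup circular distance of the unit-lattice points. [cite: Balaban1984PropagatorsI, Prop. 1.2 (1.110) p.35] -/
theorem latticeSettingP12_dist (k : ℕ) : (latticeSettingP12 n M a k).dist = distSite M := rfl

/-- unfolding: `supNorm` is `|J|` of (1.108). [cite: Balaban1984PropagatorsI, (1.108) p.35] -/
theorem latticeSettingP12_supNorm (k : ℕ) : (latticeSettingP12 n M a k).supNorm = supNormL n M := rfl

/-- unfolding: `holder` is `‖J‖_ε` of (1.109). [cite: Balaban1984PropagatorsI, (1.109) p.35] -/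
theorem latticeSettingP12_holder (k : ℕ) : (latticeSettingP12 n M a k).holder = holderL n M := rfl

/-- unfolding: the Hölder entries (1.111)/(1.113) and the sup entry (1.112). [cite: Balaban1984PropagatorsI, Prop. 1.2 (1.111)–(1.113) pp.35–36] -/
theorem latticeSettingP12_h1_e4_h2 (k : ℕ) :
    (latticeSettingP12 n M a k).h1 = h1L n M a ∧ (latticeSettingP12 n M a k).e4 = e4L n M a ∧
      (latticeSettingP12 n M a k).h2 = h2L n M a := ⟨rfl, rfl, rfl⟩

/-- unfolding: the cut-off data `cutIn`/`cutH`/`cutSup`. [cite: Balaban1984PropagatorsI, Prop. 1.2 (1.111) p.35] -/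
theorem latticeSettingP12_cut (k : ℕ) :
    (latticeSettingP12 n M a k).cutIn = cutInL n M ∧ (latticeSettingP12 n M a k).cutH = cutHL n M ∧
      (latticeSettingP12 n M a k).cutSup = cutSupL n M := ⟨rfl, rfl, rfl⟩

/-- **Proposition 1.1 for the completed torus carrier, BY NAME** (p248298's `prop11Printed_latticeSetting` with
`o := prop12FieldsLattice`): every index family, one `γ₀ = gammaZero d a`. [cite: Balaban1984PropagatorsI, Prop. 1.1 (1.89)–(1.90) p.33] -/
theorem prop11Printed_latticeSettingP12 {I : Type} (a : ℝ) (ha : 0 < a) (k : I → ℕ) (n : I → ℕ) [∀ i, NeZero (n i)]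
    (M : I → Fin d → ℕ) [∀ i μ, NeZero (M i μ)] :
    B5.Prop11Printed (fun i => latticeSettingP12 (n i) (M i) a (k i)) :=
  prop11Printed_latticeSetting a ha k n M fun i => prop12FieldsLattice (n i) (M i) a

end Carrier

end

end Literature.MathematicalPhysics.QuantumFieldTheory.Balaban1983to89.B5Prop12FieldsLattice
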